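import Summits.CriticalPhenomena.SAWScalingLimit.Theorems.SAWRenewalTightnessSubseqIdentificationRoomPassageAssembly
import Summits.CriticalPhenomena.SAWScalingLimit.Theorems.SAWRenewalTightnessRoomPassageEvents
import Summits.CriticalPhenomena.SAWScalingLimit.Theorems.SAWRenewalTightnessSubseqIdentificationSawLatticeDriversStemCapacity
import Literature.Probability.Process.DiagonalPassage
import Literature.Probability.RandomPlanarGeometry.SAWExplorationRunningMax
import HarnessLib

/-!
# `stub_roomPassageAssemblyNR`: approximate lattice drivers + guarded room data ⇒ the capped
room–entropy martingales

Stub `stub_roomPassageAssemblyNR` of the registered skeleton (reshape r7) of the line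
`room-entropy-wright-fisher`, crux `SubseqIdentification` (stmt-CriticalPhenomena-0783, route
`SAWRenewalTightness`, shared with `SAWParafermion` / `SAWLeftRightFKG` / `SAWAsymptoticMorera`;
vocabulary `Theorems/SAWRenewalTightnessRoomEntropyDefs`, `…RoomPassageDefs`, `…RoomPassageEvents`):
`SAWLatticeDriversApprox → LatticeRoomDataNR → SAWNoReturn → RoomMartingaleLimitCap`.

Proof. As in the r6b assembly p114096 (`exists_filtration_martingale_roomObsCap_of_integral_cylinder`,
`Process.integral_sub_mul_eq_zero_of_forall_lt_of_frozen`) everything reduces to the cylinder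
identity `E_μ[(N_t - N_s) ψ(W_S)] = 0` for `0 < s < t < (Im w)²/16` (`s = 0` by right-continuity,
`Process.integral_sub_mul_eq_zero_zero_of_forall_pos`). DIAGONALISATION in the tolerance: at
`ρ_m = Im w/(m+2) → 0`, (H1) (fed with `NoReturnAlong` from (H3)) gives `S₀(m) ≤ ρ_m` and drivers
`𝒱_m → frozenDriver φ S₀(m)` in law along the meshes; `frozenDriver φ S₀(m) c → drivingFunction φ c`
in `C([0,∞), ℝ)` for every `c` (`ContinuousMap.tendsto_mk_comp_max_nhds_zero`), hence in law; the
Lévy–Prokhorov metrisation of convergence in distribution on the Polish path space yields a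
diagonal `n_m` (`Process.exists_diagonal_tendstoInDistribution`) along which `𝒱_m(s_{n_m}) → W` in
law AND the scale thresholds of level `m` hold: prefix-consistency beyond `S₀(m)`, the four bad
events (`capacityEvent`; `roomDataEvent` of (H2) at radii `R_m`, `r'_m = r_m ∧ R_m/2` with `r_m` from
`NoReturnAlong`; `fidelityEvent`; `noReturnEvent`) each of probability `≤ ρ_m`, stem capacity
`≤ ρ_m` (`stub_sawLatticeDriversStemCapacity`, p116522), `0 < s_{n_m}`, `n_m ≥ m`. Per scale
(`exists_explorationData`): the exploration filtration run with the RUNNING-MAX capacity clock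
(`SAW.exists_explorationFiltration_runningMax`), the Doob martingale `roomDoob = (π/2) E_δ[X ∣ γ[0,n]]`
of the terminal room deficit, first passages `σ ≤ τ` of the levels `s ≥ S₀(m)`, `t`,
`𝒢_σ`-measurability of `𝒱 γ u`, `u ≤ s`, and, off the bad event, at the first-passage index `k`:
`t_k ∈ [level, level + ρ_m]`, `|roomDoob_k - hullRoomObs_k| ≤ ρ_m` (room data + no return),
`|N_{t_k}(𝒱 γ) - hullRoomObs_k| ≤ ρ_m` (fidelity). Then `Process.exists_passageData_of_doob`
(p113465) and `integral_cylinder_eq_zero_of_tendstoInDistribution_of_integrable` (p101958) apply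
verbatim along the diagonal. No named fact; axioms `propext`, `Classical.choice`, `Quot.sound`.

References: Chelkak–Duminil-Copin–Hongler–Kemppainen–Smirnov, C. R. Math. 352 (2014), §3;
Duminil-Copin–Smirnov, Clay Math. Proc. 15 (2012), Lemma 6.6, Prop. 6.7; Billingsley,
*Convergence of Probability Measures* (1999), Thm. 6.8.
-/


noncomputable section

open MeasureTheory Filter Topology Set
open scoped NNReal ENNReal Classical BigOperators
open Literature.Probability.LatticeModels
open Literature.Probability.RandomPlanarGeometry
open UpperHalfPlane (upperHalfPlaneSet)
open scoped PathBorel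

namespace Summit.CriticalPhenomena.SAWScalingLimit.Theorems.SubseqIdentification.RoomEntropy

/-! ## Per-scale exploration data off the four bad events -/

/-- **Per-scale Doob data off the bad events** (one mesh, finite SAW space): for drivers `V`
prefix-consistent beyond capacity `S₀ ≤ s₁ ≤ t₁`, `t₁ + θ ≤ (Im w)²/16`, stem capacity `≤ θ` — the
exploration filtration of the running-max capacity clock, first passages `σ ≤ τ ≤ M` of `s₁`, `t₁`,
the Doob identity `roomDoob = (π/2) E_δ[X ∣ 𝒢_n]`, `𝒢_σ`-measurability of `V γ u`, `u ≤ s₁`, and,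
off `capacityEvent ∪ roomDataEvent ∪ fidelityEvent ∪ noReturnEvent`, the approximation of
`roomDoob_σ`, `roomDoob_τ` by `roomObsCap (V γ) w u` within `εH + ρF` at capacity times
`u ∈ [s₁, s₁ + θ]`, `[t₁, t₁ + θ]`. [cite: CDHKSCRAS2014, §3] -/
theorem exists_explorationData {D : DobrushinDomain}
    (φ : ConformalEquiv upperHalfPlaneSet D.carrier) {δ : ℝ} {a b : Site 2}
    [Finite (SAW.DomainSAW D.carrier δ a b)] [IsProbabilityMeasure (SAW.law D.carrier δ a b)]
    (z : Site 2) (X : SAW.DomainSAW D.carrier δ a b → ℝ)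
    (hX : X = fun γ ↦ roomAt D.carrier δ ∅ z - roomAt D.carrier δ (verts γ.walk) z)
    (V : SAW.DomainSAW D.carrier δ a b → C(ℝ≥0, ℝ)) (w : ℂ)
    {S₀ s₁ t₁ : ℝ≥0} {θ εH ρF R r : ℝ} (hθ : 0 ≤ θ) (hS : S₀ ≤ s₁) (hst : s₁ ≤ t₁)
    (hT : (t₁ : ℝ) + θ ≤ w.im ^ 2 / 16)
    (hstem : ∀ γ : SAW.DomainSAW D.carrier δ a b, LatticeSlit.capTime φ (prefixAt γ 0) ≤ θ)
    (hcons : ∀ (γ γ' : SAW.DomainSAW D.carrier δ a b) (k : ℕ),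
      (prefixAt γ k).support = (prefixAt γ' k).support →
      (S₀ : ℝ) ≤ LatticeSlit.capTime φ (prefixAt γ k) →
      ∀ u : ℝ≥0, (u : ℝ) ≤ LatticeSlit.capTime φ (prefixAt γ k) → V γ u = V γ' u) :
    ∃ (𝒢 : Filtration ℕ (inferInstance : MeasurableSpace (SAW.DomainSAW D.carrier δ a b)))
      (σ τ : SAW.DomainSAW D.carrier δ a b → WithTop ℕ) (hσ : IsStoppingTime 𝒢 σ) (M : ℕ),
      IsStoppingTime 𝒢 τ ∧ StronglyAdapted 𝒢 (fun n γ ↦ roomDoob D δ a b z γ n) ∧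
      (∀ n, (fun γ ↦ roomDoob D δ a b z γ n) =ᵐ[SAW.law D.carrier δ a b] fun γ ↦
        Real.pi / 2 * ((SAW.law D.carrier δ a b)[X | 𝒢 n]) γ) ∧
      σ ≤ τ ∧ (∀ γ, τ γ ≤ M) ∧ (∀ u, u ≤ s₁ → Measurable[hσ.measurableSpace] fun γ ↦ V γ u) ∧
      ∀ γ, γ ∉ capacityEvent φ (w.im ^ 2 / 16) θ ∪ roomDataEvent D φ δ a b z w R r εH ∪
          fidelityEvent φ V S₀ w ρF ∪ noReturnEvent D δ a b R r →
        (∃ u : ℝ≥0, s₁ ≤ u ∧ (u : ℝ) ≤ s₁ + θ ∧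
          ‖((stoppedValue (fun n γ ↦ roomDoob D δ a b z γ n) σ γ : ℝ) : ℂ) -
            ((roomObsCap (V γ) w u : ℝ) : ℂ)‖ ≤ εH + ρF) ∧
        (∃ u : ℝ≥0, t₁ ≤ u ∧ (u : ℝ) ≤ t₁ + θ ∧
          ‖((stoppedValue (fun n γ ↦ roomDoob D δ a b z γ n) τ γ : ℝ) : ℂ) -
            ((roomObsCap (V γ) w u : ℝ) : ℂ)‖ ≤ εH + ρF) := by
  obtain ⟨𝒢, M, σ, τ, hσ, hτ, hστ, hτM, h𝒢, hDoob, hσmeas, hσpass, hτpass⟩ :=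
    SAW.exists_explorationFiltration_runningMax
      (fun (γ : SAW.DomainSAW D.carrier δ a b) n ↦ LatticeSlit.capTime φ (prefixAt γ n))
      (fun γ γ' n n' h ↦ SAW.apply_eq_of_support_eq
        (fun v (η : (discreteDomainGraph D.carrier δ).Walk a v) ↦ LatticeSlit.capTime φ η) h)
      hθ hstem s₁.coe_nonneg (NNReal.coe_le_coe.2 hst)
  refine ⟨𝒢, σ, τ, hσ, M, hτ, ?_, ?_, hστ, hτM, ?_, fun γ hγ ↦ ?_⟩
  · -- `roomDoob` is adapted to the exploration
    refine fun n ↦ (h𝒢 n _ fun γ γ' h ↦ ?_).stronglyMeasurable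
    exact congrArg (fun ρ : ℝ ↦ Real.pi / 2 * (roomAt D.carrier δ ∅ z - ρ))
      (SAW.apply_eq_of_support_eq
        (fun v (η : (discreteDomainGraph D.carrier δ).Walk a v) ↦ condRoom D.carrier δ a b z η) h)
  · -- `roomDoob` IS `(π/2) E_δ[X ∣ γ[0,n]]`
    intro n
    have hsub : X = (fun _ ↦ roomAt D.carrier δ ∅ z) -
        fun γ ↦ roomAt D.carrier δ (verts γ.walk) z := by rw [hX]; rfl
    filter_upwards [condExp_sub (μ := SAW.law D.carrier δ a b)
      (integrable_const (roomAt D.carrier δ ∅ z))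
      (Integrable.of_finite (f := fun γ ↦ roomAt D.carrier δ (verts γ.walk) z)) (𝒢 n),
      hDoob (SAW.law D.carrier δ a b) (fun γ ↦ roomAt D.carrier δ (verts γ.walk) z) n]
      with γ h1 h2
    rw [hsub, h1, Pi.sub_apply, condExp_const (𝒢.le n), h2]; rfl
  · -- the driver values at times `≤ s₁` are `𝒢_σ`-measurable (prefix-consistency beyond `S₀`)
    exact fun u hu ↦ hσmeas _ fun k i γ γ' _ _ hsi h ↦ hcons γ γ' i h
      ((NNReal.coe_le_coe.2 hS).trans hsi) u ((NNReal.coe_le_coe.2 hu).trans hsi)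
  -- off the exceptional event: the approximations at the first passages past `s₁`, `t₁`
  simp only [mem_union, not_or] at hγ
  obtain ⟨⟨⟨hcap, hrd⟩, hfid⟩, hnr⟩ := hγ
  simp only [capacityEvent, mem_setOf_eq, not_or, not_forall, not_exists, not_and, not_lt,
    not_le] at hcap
  obtain ⟨hex, hincr⟩ := hcap
  simp only [roomDataEvent, mem_setOf_eq, not_exists, not_and, not_lt] at hrd
  simp only [fidelityEvent, mem_setOf_eq, not_exists, not_and, not_lt] at hfid
  simp only [noReturnEvent, mem_setOf_eq, not_exists, not_and, not_le] at hnr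
  have key : ∀ (L : ℝ≥0) (ϑ : SAW.DomainSAW D.carrier δ a b → WithTop ℕ),
      (L : ℝ) + θ ≤ w.im ^ 2 / 16 → S₀ ≤ L →
      (∃ k : ℕ, ϑ γ = k ∧ (L : ℝ) ≤ LatticeSlit.capTime φ (prefixAt γ k) ∧
        LatticeSlit.capTime φ (prefixAt γ k) ≤ L + θ) →
      ∃ u : ℝ≥0, L ≤ u ∧ (u : ℝ) ≤ L + θ ∧
        ‖((stoppedValue (fun n γ ↦ roomDoob D δ a b z γ n) ϑ γ : ℝ) : ℂ) -
          ((roomObsCap (V γ) w u : ℝ) : ℂ)‖ ≤ εH + ρF := by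
    rintro L ϑ hLθ hSL ⟨j, hϑj, hLf, hup⟩
    have h0 : 0 ≤ LatticeSlit.capTime φ (prefixAt γ j) := L.coe_nonneg.trans hLf
    have hjT : LatticeSlit.capTime φ (prefixAt γ j) ≤ w.im ^ 2 / 16 := by linarith
    refine ⟨(LatticeSlit.capTime φ (prefixAt γ j)).toNNReal, ?_, ?_, ?_⟩
    · rw [← NNReal.coe_le_coe, Real.coe_toNNReal _ h0]; exact hLf
    · rw [Real.coe_toNNReal _ h0]; exact hup
    have hsv : stoppedValue (fun n γ ↦ roomDoob D δ a b z γ n) ϑ γ = roomDoob D δ a b z γ j := by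
      simp only [stoppedValue, hϑj]; rfl
    rw [hsv, ← Complex.ofReal_sub, Complex.norm_real, Real.norm_eq_abs]
    have hA := hrd j hjT fun i k hik _ hR ↦ hnr i k hik hR
    have hB := hfid j ((NNReal.coe_le_coe.2 hSL).trans hLf) hjT
    rw [abs_sub_comm] at hB
    exact (abs_sub_le _ _ _).trans (add_le_add hA hB)
  exact ⟨key s₁ σ (by linarith [NNReal.coe_le_coe.2 hst]) hS (hσpass γ _ (by linarith [NNReal.coe_le_coe.2 hst]) hex hincr),
    key t₁ τ hT (hS.trans hst) (hτpass γ _ hT hex hincr)⟩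

/-! ## The assembly -/

/-- **`SAWLatticeDriversApprox → LatticeRoomDataNR → SAWNoReturn → RoomMartingaleLimitCap`**
(registered stub `stub_roomPassageAssemblyNR` of the line `room-entropy-wright-fisher`, reshape r7,
crux `SubseqIdentification`, stmt-CriticalPhenomena-0783): see the module docstring for the proof.
-/
theorem stub_roomPassageAssemblyNR :
    (∀ (D : DobrushinDomain) (a b : ℝ → Site 2) (φ : ConformalEquiv upperHalfPlaneSet D.carrier),
      SAW.IsEndpointApprox D a b → D.IsChordalUniformizing φ →
      ∀ ρ : ℝ, 0 < ρ → ∀ (μ : Measure (CurveClass ℂ)) (s : ℕ → ℝ) [IsProbabilityMeasure μ]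
        [∀ n, IsProbabilityMeasure (SAW.law D.carrier (s n) (a (s n)) (b (s n)))],
        Tendsto s atTop (𝓝[>] (0 : ℝ)) → WeakLimitAlong D a b μ s →
        (∀ᵐ c ∂μ, IsLoewnerDescribable φ c ∧ c.source = D.pt 0) → NoReturnAlong D a b s →
        ∃ S₀ : ℝ≥0, 0 < S₀ ∧ (S₀ : ℝ) ≤ ρ ∧
        ∃ 𝒱 : (δ : ℝ) → SAW.DomainSAW D.carrier δ (a δ) (b δ) → C(ℝ≥0, ℝ),
          (∀ᶠ n in atTop, ∀ (γ γ' : SAW.DomainSAW D.carrier (s n) (a (s n)) (b (s n))) (k : ℕ),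
            (prefixAt γ k).support = (prefixAt γ' k).support →
            (S₀ : ℝ) ≤ LatticeSlit.capTime φ (prefixAt γ k) →
            ∀ u : ℝ≥0, (u : ℝ) ≤ LatticeSlit.capTime φ (prefixAt γ k) →
              𝒱 (s n) γ u = 𝒱 (s n) γ' u) ∧
          TendstoInDistribution (fun n γ => 𝒱 (s n) γ) atTop (frozenDriver φ S₀)
            (fun n => SAW.law D.carrier (s n) (a (s n)) (b (s n))) μ ∧
          (∀ w : ℂ, ρ ≤ w.im → ∀ᶠ n in atTop,
            SAW.law D.carrier (s n) (a (s n)) (b (s n)) (fidelityEvent φ (𝒱 (s n)) S₀ w ρ)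
              ≤ ENNReal.ofReal ρ) ∧
          ∀ T ε : ℝ, 0 < ε → ∀ᶠ n in atTop,
            SAW.law D.carrier (s n) (a (s n)) (b (s n)) (capacityEvent φ T ε) ≤ ENNReal.ofReal ε) →
    (∀ (D : DobrushinDomain) (a b : ℝ → Site 2) (φ : ConformalEquiv upperHalfPlaneSet D.carrier),
      SAW.IsEndpointApprox D a b → D.IsChordalUniformizing φ →
      ∀ w : ℂ, 0 < w.im → ∀ (zδ : ℝ → Site 2),
        Tendsto (fun δ => meshPoint δ (zδ δ)) (𝓝[>] (0 : ℝ)) (𝓝 (φ w)) →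
      (∀ ε : ℝ, 0 < ε → ∃ R : ℝ, ∀ᶠ δ in 𝓝[>] (0 : ℝ),
        ∫ γ in {γ : SAW.DomainSAW D.carrier δ (a δ) (b δ) |
                  R < roomAt D.carrier δ ∅ (zδ δ) - roomAt D.carrier δ (verts γ.walk) (zδ δ)},
            (roomAt D.carrier δ ∅ (zδ δ) - roomAt D.carrier δ (verts γ.walk) (zδ δ))
          ∂(SAW.law D.carrier δ (a δ) (b δ)) ≤ ε) ∧
      ∀ ε : ℝ, 0 < ε → ∃ R : ℝ, 0 < R ∧ ∀ r : ℝ, 0 < r → r < R → ∀ᶠ δ in 𝓝[>] (0 : ℝ),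
        SAW.law D.carrier δ (a δ) (b δ) (roomDataEvent D φ δ (a δ) (b δ) (zδ δ) w R r ε)
          ≤ ENNReal.ofReal ε) →
    (∀ (D : DobrushinDomain) (a b : ℝ → Site 2), SAW.IsEndpointApprox D a b →
      ∀ (μ : Measure (CurveClass ℂ)) (s : ℕ → ℝ), IsProbabilityMeasure μ →
        Tendsto s atTop (𝓝[>] (0 : ℝ)) → WeakLimitAlong D a b μ s → NoReturnAlong D a b s) →
    ∀ (D : DobrushinDomain) (a b : ℝ → Site 2)
      (φ : ConformalEquiv upperHalfPlaneSet D.carrier) (μ : Measure (CurveClass ℂ)),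
      SAW.IsEndpointApprox D a b → D.IsChordalUniformizing φ → IsProbabilityMeasure μ →
      IsSubseqLimitLaw (fun δ (γ : SAW.DomainSAW D.carrier δ (a δ) (b δ)) => γ.curve)
        (fun δ => SAW.law D.carrier δ (a δ) (b δ)) μ →
      (∀ᵐ c ∂μ, IsLoewnerDescribable φ c ∧ c.source = D.pt 0) →
      ∃ 𝓕 : Filtration ℝ≥0 (inferInstance : MeasurableSpace (CurveClass ℂ)),
        Adapted 𝓕 (fun t c => drivingFunction φ c t) ∧
        ∀ w : ℂ, 0 < w.im →
          Martingale (fun t c => roomObsStopped (drivingFunction φ c) w ⌈w.im ^ 2 / 16⌉₊ (min t (Real.toNNReal (w.im ^ 2 / 16)))) 𝓕 μ := by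
  intro H1 H2 H3 D a b φ μ hab hφ hμ hsub hdesc
  haveI := hμ
  refine exists_filtration_martingale_roomObsCap_of_integral_cylinder hφ
    fun w hw s t hst n S hS ψ hψc hψ1 ↦ ?_
  -- the mesh sequence, shifted so that all laws are probability measures; the input of (H3)
  obtain ⟨s₀, hs₀, hlim₀⟩ := hsub
  obtain ⟨n₀, hn₀⟩ := eventually_atTop.1
    (hs₀.eventually (Negative.eventually_isProbabilityMeasure_law hab))
  obtain ⟨sq, hsq⟩ : ∃ sq : ℕ → ℝ, sq = fun k ↦ s₀ (k + n₀) := ⟨_, rfl⟩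
  have hsq0 : Tendsto sq atTop (𝓝[>] (0 : ℝ)) := by
    rw [hsq]; exact hs₀.comp (tendsto_add_atTop_nat n₀)
  haveI hP : ∀ k, IsProbabilityMeasure (SAW.law D.carrier (sq k) (a (sq k)) (b (sq k))) :=
    fun k ↦ by rw [hsq]; exact hn₀ _ (Nat.le_add_left _ _)
  have hlim : WeakLimitAlong D a b μ sq := fun f ↦ by
    rw [hsq]; exact (hlim₀ f).comp (tendsto_add_atTop_nat n₀)
  have hNR : NoReturnAlong D a b sq := H3 D a b hab μ sq hμ hsq0 hlim
  -- lattice points `z_δ → φ w` and the inputs of (H2)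
  obtain ⟨zδ, hzδ⟩ : ∃ zδ : ℝ → Site 2,
      Tendsto (fun δ ↦ meshPoint δ (zδ δ)) (𝓝[>] (0 : ℝ)) (𝓝 (φ w)) := by
    refine ⟨fun δ ↦ nearestSite δ (φ w), Metric.tendsto_nhds.2 fun ε hε ↦ ?_⟩
    have e1 : ∀ᶠ δ in 𝓝[>] (0 : ℝ), δ < ε := mem_nhdsWithin_of_mem_nhds (Iio_mem_nhds hε)
    filter_upwards [e1, self_mem_nhdsWithin] with δ h1 hδ0
    exact (dist_meshPoint_nearestSite_le hδ0 _).trans_lt h1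
  obtain ⟨hUI, happR⟩ := H2 D a b φ hab hφ w hw zδ hzδ
  -- the capped observable as a bounded, jointly continuous path functional (p99035)
  obtain ⟨hNc0, hNb0⟩ := stub_roomObsFunctional w hw ⌈w.im ^ 2 / 16⌉₊
  obtain ⟨N, hN⟩ : ∃ N : ℝ≥0 → C(ℝ≥0, ℝ) → ℂ, N = fun u (W : C(ℝ≥0, ℝ)) ↦
      ((roomObsStopped W w ⌈w.im ^ 2 / 16⌉₊ (min u (Real.toNNReal (w.im ^ 2 / 16))) : ℝ) : ℂ) :=
    ⟨_, rfl⟩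
  have hNc : Continuous (Function.uncurry N) := by
    have := Complex.continuous_ofReal.comp (hNc0.comp ((continuous_fst.min (continuous_const
      (y := Real.toNNReal (w.im ^ 2 / 16)))).prodMk continuous_snd))
    rw [hN]; exact this
  have hNC : ∀ u W, ‖N u W‖ ≤ 2 * Real.log ((⌈w.im ^ 2 / 16⌉₊ : ℝ) + 1) + 3 * Real.log 2 := by
    intro u W; rw [hN, Complex.norm_real, Real.norm_eq_abs]; exact hNb0 W W.continuous _
  have hNV : ∀ (V : C(ℝ≥0, ℝ)) (u : ℝ≥0),
      N u ⟨fun r ↦ V r, V.continuous⟩ = ((roomObsCap V w u : ℝ) : ℂ) := fun V u ↦ by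
    rw [hN]; rfl
  /- the tolerances `ρ_m → 0` and the data of (H1), (H2), (H3) at every level `m` -/
  obtain ⟨ρ_, hρ_⟩ : ∃ ρ_ : ℕ → ℝ, ρ_ = fun m ↦ w.im / ((m + 2 : ℕ) : ℝ) := ⟨_, rfl⟩
  have hρpos : ∀ m, 0 < ρ_ m := fun m ↦ by
    rw [hρ_]; exact div_pos hw (Nat.cast_pos.2 (by omega))
  have hρim : ∀ m, ρ_ m ≤ w.im := fun m ↦ by
    rw [hρ_]; exact div_le_self hw.le (Nat.one_le_cast.2 (by omega))
  have hρ0 : Tendsto ρ_ atTop (𝓝 0) := by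
    rw [hρ_]; exact (tendsto_const_div_atTop_nhds_zero_nat w.im).comp (tendsto_add_atTop_nat 2)
  choose S₀ hS₀pos hS₀le 𝒱 hcons hlawm hfid hcapm using
    fun m ↦ H1 D a b φ hab hφ (ρ_ m) (hρpos m) μ sq hsq0 hlim hdesc hNR
  choose R hRpos hR using fun m ↦ happR (ρ_ m) (hρpos m)
  choose r₀ hr₀pos hr₀ using fun m ↦ hNR (R m) (ρ_ m) (hRpos m) (hρpos m)
  -- the scale thresholds of level `m` (all eventual in the mesh index)
  have hr' : ∀ m, 0 < min (r₀ m) (R m / 2) ∧ min (r₀ m) (R m / 2) < R m := fun m ↦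
    ⟨lt_min (hr₀pos m) (half_pos (hRpos m)), (min_le_right _ _).trans_lt (half_lt_self (hRpos m))⟩
  have hδpos : ∀ᶠ k in atTop, 0 < sq k := hsq0.eventually self_mem_nhdsWithin
  have hgood := fun m ↦ (hcons m).and <| (hfid m w (hρim m)).and <|
    (hcapm m (w.im ^ 2 / 16) (ρ_ m) (hρpos m)).and <|
    (hsq0.eventually (hR m _ (hr' m).1 (hr' m).2)).and <| (hr₀ m).and <|
    (hsq0.eventually (stub_sawLatticeDriversStemCapacity D a b φ hab hφ (ρ_ m) (hρpos m))).and <|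
    hδpos.and (eventually_ge_atTop m)
  /- the frozen limit drivers converge to the driving path as `S₀(m) → 0`; the diagonal -/
  have hS₀0 : Tendsto S₀ atTop (𝓝 0) := by
    rw [← NNReal.tendsto_coe]
    exact tendsto_of_tendsto_of_tendsto_of_le_of_le tendsto_const_nhds hρ0
      (fun m ↦ (S₀ m).coe_nonneg) hS₀le
  have hY : TendstoInDistribution (fun m ↦ frozenDriver φ (S₀ m)) atTop
      (fun c ↦ (⟨drivingFunction φ c, continuous_drivingFunction φ c⟩ : C(ℝ≥0, ℝ)))
      (fun _ ↦ μ) μ :=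
    tendstoInDistribution_of_ae_tendsto (fun m ↦ (hlawm m).aemeasurable_limit)
      (measurable_drivingPathOf hφ).aemeasurable (ae_of_all _ fun c ↦
        ((⟨drivingFunction φ c, continuous_drivingFunction φ c⟩ : C(ℝ≥0, ℝ))
          |>.tendsto_mk_comp_max_nhds_zero fun S₁ ↦
            (continuous_drivingFunction φ c).comp (continuous_id.max continuous_const)).comp hS₀0)
  obtain ⟨nn, hnn, hlawD⟩ :=
    Literature.Probability.Process.exists_diagonal_tendstoInDistribution hlawm hY hgood
  have hnnt : Tendsto nn atTop atTop :=
    tendsto_atTop_mono (fun m ↦ (hnn m).2.2.2.2.2.2.2) tendsto_id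
  have hsqn : Tendsto (fun m ↦ sq (nn m)) atTop (𝓝[>] (0 : ℝ)) := hsq0.comp hnnt
  haveI hPn : ∀ m, IsProbabilityMeasure
      (SAW.law D.carrier (sq (nn m)) (a (sq (nn m))) (b (sq (nn m)))) := fun m ↦ hP (nn m)
  -- the observable is frozen after the cap: `s < t' < T_w` suffices; `s = 0` by right-continuity
  have hXm : ∀ u : ℝ≥0, AEStronglyMeasurable (fun c : CurveClass ℂ ↦
      roomObsStopped (drivingFunction φ c) w ⌈w.im ^ 2 / 16⌉₊
        (min u (Real.toNNReal (w.im ^ 2 / 16)))) μ := fun u ↦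
    ((hNc0.comp ((continuous_const (y := min u (Real.toNNReal (w.im ^ 2 / 16)))).prodMk
      continuous_id)).measurable.comp_aemeasurable
        (measurable_drivingPathOf hφ).aemeasurable).aestronglyMeasurable
  have hΨm : AEStronglyMeasurable (fun c : CurveClass ℂ ↦ ψ fun k ↦ drivingFunction φ c (S k)) μ :=
    (hψc.measurable.comp (measurable_pi_lambda _ fun k ↦
      (stronglyMeasurable_drivingFunction_apply hφ (S k)).measurable)).aestronglyMeasurable
  refine Literature.Probability.Process.integral_sub_mul_eq_zero_of_forall_lt_of_frozen
    (μ := μ) (T := Real.toNNReal (w.im ^ 2 / 16))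
    (X := fun u c ↦ roomObsStopped (drivingFunction φ c) w ⌈w.im ^ 2 / 16⌉₊
      (min u (Real.toNNReal (w.im ^ 2 / 16))))
    (fun u hu c ↦ by simp only [min_eq_right hu, min_self])
    (fun c ↦ continuous_roomObsStopped_min (continuous_drivingFunction φ c) hw _ _)
    hXm (fun u c ↦ hNb0 _ (continuous_drivingFunction φ c) _) hΨm (fun c ↦ hψ1 _)
    (fun t' hst' ht'T ↦ ?_) hst
  have ht'r : (t' : ℝ) < w.im ^ 2 / 16 := by
    rw [← Real.coe_toNNReal (w.im ^ 2 / 16) (by positivity)]; exact_mod_cast ht'T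
  suffices key : ∀ s₁ : ℝ≥0, 0 < s₁ → s₁ < t' → (∀ k, S k ≤ s₁) →
      ∫ c, (roomObsStopped (drivingFunction φ c) w ⌈w.im ^ 2 / 16⌉₊
              (min t' (Real.toNNReal (w.im ^ 2 / 16))) -
            roomObsStopped (drivingFunction φ c) w ⌈w.im ^ 2 / 16⌉₊
              (min s₁ (Real.toNNReal (w.im ^ 2 / 16)))) *
          ψ (fun k ↦ drivingFunction φ c (S k)) ∂μ = 0 by
    rcases eq_or_ne s 0 with hs0 | hs0
    · subst hs0
      exact Literature.Probability.Process.integral_sub_mul_eq_zero_zero_of_forall_pos (μ := μ)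
        (X := fun u c ↦ roomObsStopped (drivingFunction φ c) w ⌈w.im ^ 2 / 16⌉₊
          (min u (Real.toNNReal (w.im ^ 2 / 16))))
        (fun c ↦ continuous_roomObsStopped_min (continuous_drivingFunction φ c) hw _ _)
        hXm (fun u c ↦ hNb0 _ (continuous_drivingFunction φ c) _) hΨm (fun c ↦ hψ1 _) hst'
        fun s₁ hs₁ hs₁t ↦ key s₁ hs₁ hs₁t fun k ↦ (hS k).trans zero_le
    · exact key s (pos_iff_ne_zero.2 hs0) hst' hS
  intro s₁ hs₁ hs₁t hS₁
  /- the case `0 < s₁ < t' < T_w`: passage along the diagonal; the terminal room deficits -/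
  obtain ⟨X, hX⟩ : ∃ X : ∀ m, SAW.DomainSAW D.carrier (sq (nn m)) (a (sq (nn m))) (b (sq (nn m))) → ℝ,
      X = fun m γ ↦ roomAt D.carrier (sq (nn m)) ∅ (zδ (sq (nn m))) -
        roomAt D.carrier (sq (nn m)) (verts γ.walk) (zδ (sq (nn m))) := ⟨_, rfl⟩
  have hXev : ∀ᶠ m in atTop, Measurable (X m) ∧ (∀ γ, 0 ≤ X m γ) ∧
      Integrable (X m) (SAW.law D.carrier (sq (nn m)) (a (sq (nn m))) (b (sq (nn m)))) := by
    refine Eventually.of_forall fun m ↦ ?_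
    have hδ : 0 < sq (nn m) := (hnn m).2.2.2.2.2.2.1
    haveI := TPToTraversalBound.Radial.finite_domainSAW D.isBounded hδ (a (sq (nn m))) (b (sq (nn m)))
    refine ⟨SAW.DomainSAW.measurable_of_top _, fun γ ↦ ?_, Integrable.of_finite⟩
    rw [hX]; exact sub_nonneg.2 (SRW.killedGreen_fromRel_notMem_le
      (SRW.finite_support_discreteDomainGraph D.isBounded hδ) _ _ _)
  have hUI' : ∀ ε : ℝ, 0 < ε → ∃ R : ℝ, ∀ᶠ m in atTop,
      ∫ γ in {γ | R < X m γ}, X m γ ∂SAW.law D.carrier (sq (nn m)) (a (sq (nn m))) (b (sq (nn m)))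
        ≤ ε := by
    intro ε hε
    obtain ⟨R, hR⟩ := hUI ε hε
    exact ⟨R, by rw [hX]; exact hsqn.eventually hR⟩
  have main := fun hD ↦ Literature.Probability.Process.exists_passageData_of_doob
    (P := fun m ↦ SAW.law D.carrier (sq (nn m)) (a (sq (nn m))) (b (sq (nn m))))
    (V := fun m u γ ↦ 𝒱 m (sq (nn m)) γ u)
    (Φ := fun m u γ ↦ N u ⟨fun r ↦ 𝒱 m (sq (nn m)) γ r, (𝒱 m (sq (nn m)) γ).continuous⟩)
    hXev hUI' (Real.pi / 2) s₁ t' hS₁ hψc.measurable hψ1 hD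
  refine (main ?doob).elim fun ε hrest ↦ ?passage
  case passage =>
    obtain ⟨Δ, η, hε, hΔ, hη, happrox⟩ := hrest
    have key := integral_cylinder_eq_zero_of_tendstoInDistribution_of_integrable (μ := μ)
      (P := fun m ↦ SAW.law D.carrier (sq (nn m)) (a (sq (nn m))) (b (sq (nn m))))
      (W := fun u c ↦ drivingFunction φ c u) (fun c ↦ continuous_drivingFunction φ c)
      (V := fun m u γ ↦ 𝒱 m (sq (nn m)) γ u) (fun m γ ↦ (𝒱 m (sq (nn m)) γ).continuous)
      hlawD hNc hNC s₁ t' S hψc hψ1 hε hΔ hη happrox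
    rw [hN] at key
    simp only [ContinuousMap.coe_mk, ← Complex.ofReal_sub, ← Complex.ofReal_mul,
      integral_complex_ofReal, Complex.ofReal_eq_zero] at key
    exact key
  /- the Doob data at every tolerance `ρ` and every large level `m` of the diagonal -/
  case doob =>
  filter_upwards [self_mem_nhdsWithin] with ρ (hρ : 0 < ρ)
  have e1 : ∀ᶠ m in atTop, ρ_ m ≤ ρ / 4 := hρ0.eventually (Iic_mem_nhds (by positivity))
  have e2 : ∀ᶠ m in atTop, ρ_ m ≤ min (s₁ : ℝ) (w.im ^ 2 / 16 - t') :=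
    hρ0.eventually (Iic_mem_nhds (lt_min (by exact_mod_cast hs₁) (sub_pos.2 ht'r)))
  filter_upwards [e1, e2] with m hm1 hm2
  obtain ⟨hco, hfi, hca, hrd, hnr, hst0, hδ, -⟩ := hnn m
  set δm := sq (nn m) with hδm
  haveI := TPToTraversalBound.Radial.finite_domainSAW D.isBounded hδ (a δm) (b δm)
  have hS₀s : S₀ m ≤ s₁ := NNReal.coe_le_coe.1 ((hS₀le m).trans (hm2.trans (min_le_left _ _)))
  have hTm : (t' : ℝ) + ρ_ m ≤ w.im ^ 2 / 16 := by linarith [hm2.trans (min_le_right _ _)]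
  obtain ⟨𝒢, σ, τ, hσ, M, hτ, hGad, hG, hστ, hτM, hVm, happ⟩ :=
    exists_explorationData φ (zδ δm) (X m) (by rw [hX]) (𝒱 m δm) w
      (εH := ρ_ m) (ρF := ρ_ m) (R := R m) (r := min (r₀ m) (R m / 2))
      (hρpos m).le hS₀s hs₁t.le hTm hst0 hco
  refine ⟨𝒢, fun n γ ↦ roomDoob D δm (a δm) (b δm) (zδ δm) γ n, σ, τ, hσ, M,
    capacityEvent φ (w.im ^ 2 / 16) (ρ_ m) ∪
      roomDataEvent D φ δm (a δm) (b δm) (zδ δm) w (R m) (min (r₀ m) (R m / 2)) (ρ_ m) ∪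
      fidelityEvent φ (𝒱 m δm) (S₀ m) w (ρ_ m) ∪
      noReturnEvent D δm (a δm) (b δm) (R m) (min (r₀ m) (R m / 2)),
    hτ, hGad, hG, hστ, hτM, hVm, MeasurableSpace.measurableSet_top, ?_, fun γ hγ ↦ ?_⟩
  · -- the exceptional event is small
    have hnr' : SAW.law D.carrier δm (a δm) (b δm) (noReturnEvent D δm (a δm) (b δm) (R m)
        (min (r₀ m) (R m / 2))) ≤ ENNReal.ofReal (ρ_ m) :=
      (measure_mono (noReturnEvent_mono D _ _ _ (R m) (min_le_left _ _))).trans hnr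
    have h4 : ∀ A B C E : Set (SAW.DomainSAW D.carrier δm (a δm) (b δm)),
        SAW.law D.carrier δm (a δm) (b δm) (A ∪ B ∪ C ∪ E) ≤
          SAW.law _ _ _ _ A + SAW.law _ _ _ _ B + SAW.law _ _ _ _ C + SAW.law _ _ _ _ E :=
      fun A B C E ↦ (measure_union_le _ _).trans (by
        gcongr; exact (measure_union_le _ _).trans (by gcongr; exact measure_union_le _ _))
    refine (h4 _ _ _ _).trans ?_
    calc _ ≤ ENNReal.ofReal (ρ_ m) + ENNReal.ofReal (ρ_ m) + ENNReal.ofReal (ρ_ m) +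
          ENNReal.ofReal (ρ_ m) := by gcongr
      _ = ENNReal.ofReal (ρ_ m + ρ_ m + ρ_ m + ρ_ m) := by
          rw [ENNReal.ofReal_add (by linarith [hρpos m]) (hρpos m).le,
            ENNReal.ofReal_add (by linarith [hρpos m]) (hρpos m).le,
            ENNReal.ofReal_add (hρpos m).le (hρpos m).le]
      _ ≤ ENNReal.ofReal ρ := ENNReal.ofReal_le_ofReal (by linarith)
  · -- off the exceptional event: the approximations at the first passages past `s₁`, `t'`
    obtain ⟨⟨u, h1, h2, h3⟩, ⟨u', h1', h2', h3'⟩⟩ := happ γ hγ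
    rw [← hNV] at h3 h3'
    exact ⟨⟨u, h1, h2.trans (by linarith), h3.trans (by linarith)⟩,
      ⟨u', h1', h2'.trans (by linarith), h3'.trans (by linarith)⟩⟩

end Summit.CriticalPhenomena.SAWScalingLimit.Theorems.SubseqIdentification.RoomEntropy

end
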